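import Summits.QuantumAdvantage.QuantumAdvantage.Theses.CodimDial
import Summits.QuantumAdvantage.QuantumAdvantage.Theorems.CodimDialFewSplitGlue
/-!
# CodimDial — the assembly item (stmt-QuantumAdvantage-28377)

The assembly statement of route `route-QuantumAdvantage-CodimDial` is, binder for binder, the route's deciding theorem
`Theses.CodimDial.closes` (gate-written, 0 sorry): the pieces in rank order imply the registered leaf.  This file records the
assembly item as PROVED by that composition (decomp-qadv landing lane, census seat g7; bookkeeping — no piece is decided here).
-/

set_option linter.dupNamespace false

namespace Summit.QuantumAdvantage.QuantumAdvantage.Theorems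

/-- **Assembly of route CodimDial** (item 28377): the route's pieces, taken as hypotheses in rank order, yield its leaf —
literally the deciding theorem `Theses.CodimDial.closes`. -/
theorem codimDial_assembly : Summit.QuantumAdvantage.QuantumAdvantage.Theses.CodimDial.Assembly :=
  fun hP hAlg hA hB =>
    Summit.QuantumAdvantage.QuantumAdvantage.Theses.CodimDial.closes hP hAlg hA hB codimDial_fewSplitGlue3

end Summit.QuantumAdvantage.QuantumAdvantage.Theorems
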